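import Mathlib

/-!
# D-imc-71, skeleton step S4 — the linear algebra of the ψ₂-corank trichotomy (kernel-checked core)

Cell `bsd-f1-sign2`, seat `-imc` g28.  Pure linear algebra over a field `K` with `2 ≠ 0`; no arithmetic input.

* `mem_span_or_mem_span_of_isotropic` — in a hyperbolic plane (spanned by isotropic `e`, `f` with `B e f ≠ 0`,
  `B` symmetric) every isotropic vector lies on one of the TWO isotropic lines `K∙e`, `K∙f`.  (At a REAL character —
  ψ₂ at `p = 2` — the local Tate form on `H¹(ℚ₂, V)` is symmetric bilinear and the localisation of a global class is
  isotropic, hence on `H¹_f = K∙e` or on its partner `H¹_w = K∙f`; at complex characters the constraint is Hermitian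
  and carries no such rigidity.)
* `finrank_comap_eq_finrank_ker_add` — for `loc : S →ₗ P` and a local condition `L ≤ P`:
  `dim loc⁻¹(L) = dim ker loc + dim (L ⊓ range loc)`  («Selmer = strict Selmer + the part of the global image inside L»).
* `finrank_inf_eq_ite_of_finrank_eq_one` — two lines meet in dimension `1` or `0` according as they are equal or not.
* `exists_isotropic_partner`, `span_partner_le_ker`, `ker_eq_span_partner` — the hyperbolic structure and the (Wα)+(Wβ)
  PINNING of the blind line: a functional killing an isotropic vector off `K∙e` and not identically zero has kernel `K∙f`.
* `selmer_trichotomy_count` — the three counts `dim ker loc + 1` / `dim ker loc` / `dim ker loc` for `L =` the global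
  image line / the other isotropic line / any line different from the image (e.g. an anisotropic one).
-/

set_option autoImplicit false

namespace Summit.BirchSwinnertonDyer.Rank1Residual.F1Sign2.ImcG28

open Module

section Isotropic

variable {K : Type*} [Field K] {P : Type*} [AddCommGroup P] [Module K P]

/-- In the plane spanned by an isotropic pair `e, f` with `B e f ≠ 0`, `B` symmetric on the pair and `2 ≠ 0` in `K`,
every isotropic vector lies on one of the two isotropic lines. -/
theorem mem_span_or_mem_span_of_isotropic (B : LinearMap.BilinForm K P) (h2 : (2 : K) ≠ 0) {e f v : P}
    (he : B e e = 0) (hf : B f f = 0) (hfe : B f e = B e f) (hef : B e f ≠ 0)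
    (hv : v ∈ Submodule.span K {e, f}) (hiso : B v v = 0) :
    v ∈ Submodule.span K {e} ∨ v ∈ Submodule.span K {f} := by
  rw [Submodule.mem_span_pair] at hv
  obtain ⟨a, b, rfl⟩ := hv
  have h : 2 * (a * b) * B e f = 0 := by
    have h0 := hiso
    simp only [map_add, map_smul, LinearMap.add_apply, LinearMap.smul_apply, smul_eq_mul, he, hf, hfe] at h0
    linear_combination h0
  have hab : a * b = 0 := by
    rcases mul_eq_zero.mp h with h' | h'
    · rcases mul_eq_zero.mp h' with h'' | h''
      · exact absurd h'' h2
      · exact h''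
    · exact absurd h' hef
  rcases mul_eq_zero.mp hab with ha | hb
  · right
    subst ha
    simp only [zero_smul, zero_add]
    exact Submodule.smul_mem _ _ (Submodule.mem_span_singleton_self f)
  · left
    subst hb
    simp only [zero_smul, add_zero]
    exact Submodule.smul_mem _ _ (Submodule.mem_span_singleton_self e)

/-- The two isotropic lines of a hyperbolic pair are distinct: `f ∉ K∙e`. -/
theorem not_mem_span_of_hyperbolic (B : LinearMap.BilinForm K P) {e f : P}
    (he : B e e = 0) (hef : B e f ≠ 0) : f ∉ Submodule.span K {e} := by
  intro hf
  rw [Submodule.mem_span_singleton] at hf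
  obtain ⟨a, rfl⟩ := hf
  apply hef
  simp [he]

end Isotropic

section Count

variable {K : Type*} [Field K] {S P : Type*} [AddCommGroup S] [Module K S] [AddCommGroup P] [Module K P]

/-- **Selmer = strict + (global image inside the condition).**  For a linear map `loc : S → P` and a subspace
`L ≤ P`: `dim loc⁻¹(L) = dim ker loc + dim (L ⊓ range loc)`. -/
theorem finrank_comap_eq_finrank_ker_add [FiniteDimensional K S] (loc : S →ₗ[K] P) (L : Submodule K P) :
    finrank K (L.comap loc) = finrank K (LinearMap.ker loc) + finrank K ↥(L ⊓ LinearMap.range loc) := by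
  set g : L.comap loc →ₗ[K] P := loc.domRestrict (L.comap loc) with hg
  have hker : LinearMap.ker g = (LinearMap.ker loc).comap (L.comap loc).subtype := by
    rw [hg, LinearMap.ker_domRestrict]
  have hrange : LinearMap.range g = L ⊓ LinearMap.range loc := by
    rw [hg, LinearMap.range_domRestrict, Submodule.map_comap_eq, inf_comm]
  have hle : LinearMap.ker loc ≤ L.comap loc := by
    intro x hx
    rw [LinearMap.mem_ker] at hx
    simp [Submodule.mem_comap, hx]
  have h1 : finrank K (LinearMap.ker g) = finrank K (LinearMap.ker loc) := by
    rw [hker]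
    exact (Submodule.comapSubtypeEquivOfLe hle).finrank_eq
  have h2 : finrank K (LinearMap.range g) = finrank K ↥(L ⊓ LinearMap.range loc) := by
    rw [hrange]
  have h3 := LinearMap.finrank_range_add_finrank_ker g
  omega

/-- Two lines meet in dimension `1` if they are equal and `0` otherwise. -/
theorem finrank_inf_eq_ite_of_finrank_eq_one (L M : Submodule K P) [FiniteDimensional K L]
    [FiniteDimensional K M] (hL : finrank K L = 1) (hM : finrank K M = 1) :
    finrank K ↥(L ⊓ M) = if L = M then 1 else 0 := by
  classical
  split_ifs with h
  · subst h
    rw [inf_idem, hL]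
  · have hle : finrank K ↥(L ⊓ M) ≤ 1 := hL ▸ Submodule.finrank_mono inf_le_left
    rcases Nat.le_one_iff_eq_zero_or_eq_one.mp hle with h0 | h1
    · exact h0
    · exfalso
      apply h
      have hLM : L ⊓ M = L := Submodule.eq_of_le_of_finrank_eq inf_le_left (by rw [h1, hL])
      have hML : L ⊓ M = M := Submodule.eq_of_le_of_finrank_eq inf_le_right (by rw [h1, hM])
      rw [← hLM, hML]

/-- **The trichotomy count.**  If the global image `range loc` is a line `Λ`, then for a line `L`:
`dim loc⁻¹(L) = dim ker loc + 1` if `L = Λ`, and `= dim ker loc` if `L ≠ Λ` (the other isotropic line, or an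
anisotropic line).  With `dim ker loc = r ∸ 1 + [r = 0]·0` … this is the `r / |r−1| / r∸1` table of MEMO-imc §10.110
once `Λ = H¹_f` for `r ≥ 1` and `Λ = H¹_w` for `r = 0` is fed in. -/
theorem selmer_trichotomy_count [FiniteDimensional K S] [FiniteDimensional K P] (loc : S →ₗ[K] P)
    (L : Submodule K P) (hL : finrank K L = 1) (hΛ : finrank K (LinearMap.range loc) = 1) :
    finrank K (L.comap loc) = finrank K (LinearMap.ker loc) + (if L = LinearMap.range loc then 1 else 0) := by
  rw [finrank_comap_eq_finrank_ker_add, finrank_inf_eq_ite_of_finrank_eq_one L (LinearMap.range loc) hL hΛ]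

end Count

section Pinning

variable {K : Type*} [Field K] {P : Type*} [AddCommGroup P] [Module K P]

/-- **Existence of the partner line.**  A symmetric form with an isotropic vector `e` and a vector `g` with
`B e g ≠ 0` (non-degeneracy on the plane `K∙e + K∙g`) has a second isotropic vector `f = g − (B g g / (2 B e g)) • e`
with `B e f = B e g ≠ 0`: the plane is HYPERBOLIC. -/
theorem exists_isotropic_partner (B : LinearMap.BilinForm K P) (h2 : (2 : K) ≠ 0) {e g : P}
    (he : B e e = 0) (hsym : B g e = B e g) (heg : B e g ≠ 0) :
    ∃ f : P, B f f = 0 ∧ B e f = B e g ∧ B f e = B e f ∧ f ∈ Submodule.span K {e, g} := by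
  refine ⟨g - (B g g / (2 * B e g)) • e, ?_, ?_, ?_, ?_⟩
  · simp only [map_sub, map_smul, LinearMap.sub_apply, LinearMap.smul_apply, smul_eq_mul, he, hsym]
    field_simp
    ring
  · simp [he]
  · simp [he, hsym]
  · rw [Submodule.mem_span_pair]
    exact ⟨-(B g g / (2 * B e g)), 1, by simp [sub_eq_add_neg, add_comm, neg_smul]⟩

/-- **(Wβ) pins the blind line from below.**  If a linear functional `c` on the hyperbolic plane kills an ISOTROPIC
vector `z₁ ∉ K∙e` (Kato's class at a rank-0 twist: isotropic by global duality, off `H¹_f = K∙e` by `exp* ≠ 0`, killed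
by the exact blind law), then `K∙f ≤ ker c`. -/
theorem span_partner_le_ker (B : LinearMap.BilinForm K P) (h2 : (2 : K) ≠ 0) {e f z₁ : P}
    (he : B e e = 0) (hf : B f f = 0) (hfe : B f e = B e f) (hef : B e f ≠ 0)
    (c : P →ₗ[K] K) (hz : z₁ ∈ Submodule.span K {e, f}) (hiso : B z₁ z₁ = 0)
    (hoff : z₁ ∉ Submodule.span K {e}) (hkill : c z₁ = 0) :
    Submodule.span K {f} ≤ LinearMap.ker c := by
  have hz' : z₁ ∈ Submodule.span K {f} := by
    rcases mem_span_or_mem_span_of_isotropic B h2 he hf hfe hef hz hiso with h | h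
    · exact absurd h hoff
    · exact h
  rw [Submodule.mem_span_singleton] at hz'
  obtain ⟨a, rfl⟩ := hz'
  have ha : a ≠ 0 := by
    rintro rfl
    apply hoff
    simp
  rw [Submodule.span_le, Set.singleton_subset_iff, SetLike.mem_coe, LinearMap.mem_ker]
  have : a * c f = 0 := by simpa using hkill
  exact (mul_eq_zero.mp this).resolve_left ha

/-- **(Wα) + (Wβ) pin the blind line exactly.**  In the plane `P = K∙e ⊔ K∙f` (finite-dimensional of dimension 2):
if `c` kills an isotropic `z₁ ∉ K∙e` and does NOT kill some `z₀` (so `c ≠ 0`), then `ker c = K∙f` — the ψ₂-descended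
♭ line IS the partner line `H¹_w`. -/
theorem ker_eq_span_partner [FiniteDimensional K P] (B : LinearMap.BilinForm K P) (h2 : (2 : K) ≠ 0)
    {e f z₁ z₀ : P} (he : B e e = 0) (hf : B f f = 0) (hfe : B f e = B e f) (hef : B e f ≠ 0)
    (hP : finrank K P = 2) (c : P →ₗ[K] K) (hz : z₁ ∈ Submodule.span K {e, f}) (hiso : B z₁ z₁ = 0)
    (hoff : z₁ ∉ Submodule.span K {e}) (hkill : c z₁ = 0) (hz₀ : c z₀ ≠ 0) :
    LinearMap.ker c = Submodule.span K {f} := by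
  have hle : Submodule.span K {f} ≤ LinearMap.ker c := span_partner_le_ker B h2 he hf hfe hef c hz hiso hoff hkill
  have hf0 : f ≠ 0 := by
    rintro rfl
    exact hef (by simp)
  have h1 : finrank K (Submodule.span K ({f} : Set P)) = 1 := finrank_span_singleton hf0
  -- `ker c` is a proper subspace (c ≠ 0) of the 2-dimensional `P`, so it has dimension ≤ 1
  have hc : c ≠ 0 := by
    rintro rfl
    exact hz₀ rfl
  have hrange : finrank K (LinearMap.range c) = 1 := by
    have hle1 : finrank K (LinearMap.range c) ≤ 1 := by
      calc finrank K (LinearMap.range c) ≤ finrank K K := Submodule.finrank_le _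
        _ = 1 := Module.finrank_self K
    have hpos : 0 < finrank K (LinearMap.range c) := by
      rw [Module.finrank_pos_iff_exists_ne_zero]
      exact ⟨⟨c z₀, LinearMap.mem_range_self c z₀⟩, by simpa using hz₀⟩
    omega
  have hker : finrank K (LinearMap.ker c) = 1 := by
    have := LinearMap.finrank_range_add_finrank_ker c
    omega
  exact (Submodule.eq_of_le_of_finrank_eq hle (by rw [h1, hker])).symm

end Pinning

end Summit.BirchSwinnertonDyer.Rank1Residual.F1Sign2.ImcG28
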